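import Summits.MatrixMultiplication.OmegaCensus.STPP222IcosetCriterion
import Mathlib.LinearAlgebra.Dual.Lemmas
import Mathlib.FieldTheory.Finite.Basic

/-!
# ω-census, icoset reduction — the WITNESS (dual) form of the rescue condition, valid at every 2-rank

HONEST FRAMING (pub-omega census; verbatim): lottery ticket; floor = certified bounds/negative ranges.
Census STRUCTURE bookkeeping (Q7; companion of `STPP222IcosetCriterion.lean`, Pb182), nothing about `ω`.

`STPP222IcosetCriterion.lean` proves, for proper icoset data in `V × H` (`V` ANY `ZMod 2`-module — no rank hypothesis),
`IsSTPP ⟺ (T) ∧ (N)` with (N): every non-constant zero-`h` index triple is RESCUED, `off(i,j,k) ∉ span{slots}`.  The cell's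
rank-≥ 4 solvers (`icr` / `icw`, ENG2 gen 28, `HOME/pub-omega-eng2-g28/icoset/ICR-NOTE.md` 'EXACT criterion') use the dual
WITNESS form instead: a triple is rescued iff some linear functional `u` vanishes on its six slots and takes the value `1` on
its offset.  This file records that equivalence in the kernel (`Icoset.Data.rescued_iff_exists_dual`, separation of a point
from a subspace by a functional over the field `𝔽₂`) and the resulting witness form of the whole criterion
(`Icoset.Data.isSTPP_iff_witness`).  Nothing here is rank-specific; no census cell is decided.
References: H. Cohn, R. Kleinberg, B. Szegedy, C. Umans, FOCS 2005 (arXiv:math/0511460), Def. 5.1.  Seat pub-omega-kernel-l4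
(gen 19), 2026-08-27.
-/

namespace Summit.MatrixMultiplication.OmegaCensus

open Literature.Computability.AlgebraicComplexity

namespace Icoset

namespace Data

variable {V H : Type*} [AddCommGroup V] [Module (ZMod 2) V] {K : ℕ} (d : Data V H K)

/-- **Witness form of RESCUED.**  `off(i,j,k) ∉ span{slots}` iff some `𝔽₂`-linear functional kills the six slots and is `1` on
the offset (ENG2 g28's `u ∈ Ann(slots)`, `u(off) = 1`). [folklore] -/
theorem rescued_iff_exists_dual (i j k : Fin K) :
    d.Rescued i j k ↔ ∃ φ : Module.Dual (ZMod 2) V, (∀ r, φ (d.slots i j k r) = 0) ∧ φ (d.off i j k) = 1 := by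
  rw [rescued_iff_notMem_span]
  constructor
  · intro hx
    obtain ⟨f, hf, hmap⟩ := Submodule.exists_dual_map_eq_bot_of_notMem hx inferInstance
    refine ⟨f, fun r => ?_, ?_⟩
    · have : f (d.slots i j k r) ∈ (Submodule.span (ZMod 2) (Set.range (d.slots i j k))).map f :=
        Submodule.mem_map_of_mem (Submodule.subset_span ⟨r, rfl⟩)
      rw [hmap] at this
      simpa using this
    · rcases zmod2_cases (f (d.off i j k)) with h | h
      · exact absurd h hf
      · exact h
  · rintro ⟨φ, hφ, h1⟩ hmem
    have hker : Submodule.span (ZMod 2) (Set.range (d.slots i j k)) ≤ LinearMap.ker φ := by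
      rw [Submodule.span_le]
      rintro _ ⟨r, rfl⟩
      exact hφ r
    have := hker hmem
    rw [LinearMap.mem_ker, h1] at this
    exact one_ne_zero this

variable [AddCommGroup H] [DecidableEq V] [DecidableEq H]

/-- **The icoset criterion in witness form** (the shape implemented by the rank-≥ 4 class solvers): proper data is STPP iff
(T) every `(sA t, sB t, sC t)` is independent and every non-constant index triple with `h(i,j,k) = 0` has a functional
vanishing on its slots with value `1` on its offset. [cite: CohnKleinbergSzegedyUmans2005, Def. 5.1] -/
theorem isSTPP_iff_witness (hd : d.Proper) :
    IsSTPP d.A d.B d.C ↔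
      (∀ t, d.Indep t) ∧ ∀ i j k : Fin K, ¬ (i = j ∧ j = k) → d.h i j k = 0 →
        ∃ φ : Module.Dual (ZMod 2) V, (∀ r, φ (d.slots i j k r) = 0) ∧ φ (d.off i j k) = 1 := by
  rw [d.isSTPP_iff hd]
  refine and_congr_right fun _ => forall₃_congr fun i j k => ?_
  rw [d.rescued_iff_exists_dual]

end Data

end Icoset

end Summit.MatrixMultiplication.OmegaCensus
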